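import Summits.QuantumFields.BalabanUV.Beta.D1BFx.SplitRecut
import Summits.QuantumFields.BalabanUV.Beta.D1BFx.FrozenLegProfile

/-!
# `BalabanUV.Beta.D1BFx.GhostBubbleRestSplit` — road «BF-x» for binder row D1, slot (K), LOCAL group, «L-GBUB IDENTITY» (owner ruling ρ-g11-4 (b)):
# THE THREE RE-CUT LOCAL GHOST-BUBBLE WORDS SUM TO THE FULL KIN×KIN GHOST BUBBLE MINUS THE FROZEN-LEG BUBBLE —
# `Σ_{(r,r′)} restK′ (inr³ (inl (0,0,r,r′))) = ωgh·cK²·n⁻⁸·w_μw_ν·(baseKer (biBubbleTable Ggh Ggh ghCur ghCur) − baseKer (biBubbleTable fL fL ghCur ghCur))`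
# pointwise, at `fullSum` level and summed over the block (profile `gfrz`), PLUS THE HOMOGENEITY OF THE TWO-LEG WORD `W(c•A, d•B) = c·d·W(A, B)` — NO ESTIMATE

HONEST DEPENDENCY (page 1, mandatory): continuum YM on T⁴ ⇐ BetaPertH ∧ nine spine estimates (0/9 proved); BetaPertH ⇐ (D1) ∧ (D4) ∧
CAP+tail; G-an2-4 gates asym, D1 and NE2/3/4.  HONEST FRAMING (cell contract, verbatim): «discharging `BetaPertH` makes Bałaban's UV
stability UNCONDITIONAL — a real constructive-QFT result; it is NOT the continuum limit and NOT the Clay problem.»  THIS MODULE DISCHARGES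
NOTHING of the wall: [folklore] LINEAR ALGEBRA OF ABSOLUTELY CONVERGENT LATTICE SUMS composed BY NAME over the tree — the re-cut word list
(`SplitRecut.restK'_gbub`: the `0000` ghost word is `0`), the frozen-leg split of the ghost table (`FineHessianGhostGrades.biBubbleTable_Ggh_eq_pieceSum`,
`ghLeg`, `ghSec`, `ghWt`, `conv_biBubbleTable_ghost`), the unconditional homogeneity of `comp`∕`tr` (`StencilRealisation.comp_smul_left∕right`, `tr_smul`),
`fullSum` bookkeeping (`WindowIdentification.fullSum_const_mul`, `Assembly.fullSum_sub'`∕`fullSum_finset_sum`∕`exists_tendsto_psum_weight_mul`), the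
frozen profile's decay (`FrozenLegProfile.decay_gfrz`).  No `def`, no `def … : Prop`, nothing cited, no printed statement among the hypotheses, 0 sorry.
0 wall binders instantiated; NOT a bound on any word; (K) NOT closed; NOT D1, NOT `BetaPertH`, NOT continuum, NOT Clay.

ABSOLUTE RULE (cell charter, verbatim): «No internally-minted statement may enter as a cited fact. Every hypothesis is either kernel-proved in
this package or a verbatim quotation of a PUBLISHED theorem with page reference. The manuscript(s) under audit are NOT citable for their own
disputed steps — they are the thing under adjudication; programme-internal (2001/route/tribunal) claims are never citable.»

WHY (owner d1-p2-g11, ruling ρ-g11-4, `CLAIMS.log` 2026-08-21T13:55:01Z, adopting this lineage's located finding F-gan24leaf05-g41-1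
`HOME/b2b-balaban-gan24-formalise-leaf-05/g41/F1-LGBUB-units.md`): the END `RoadEndBFxRows.hGrp_of_rows` ∕ `LocalGroupRow.hLoc_of_prop12` DISPLAYS
n-uniform bounds `hGbub` for the three local ghost-bubble words `inr³ (inl (0,0,r,r′))`, `(r,r′) ≠ (0,0)` (sectors KIN × KIN, legs graded by
`ghLeg n a (gfrz n a b) = ![frozenLeg gfrz, Ggh − frozenLeg gfrz]`).  Under the END's displayed pin `hω` (reading (i)) the grade-1 ghost leg is LEADING,
not a remainder, so those per-word bounds are not available; what IS available, under either reading, is the exact bilinear identity of this file: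
the three words together are the FULL KIN × KIN ghost bubble over the raw leg `Ggh` minus MAIN-gh's parent word over the frozen leg — the input of any
re-split of the LOCAL row (ρ-g11-4 (i)) — and the homogeneity rule that moves the normalisation `Gf = n²•Ggh` through the word (ρ-g11-4 (ii)).
«L-GBUB» as a BOUND is withdrawn by the owner (Q-GU-1 → an2); this file asserts no bound.

CONTENT (`n` block side `[NeZero n]`; every `restK'` parameter free; `b w : Pt`).
* §1 [folklore] HOMOGENEITY IN THE LEGS, unconditional: `biBubble_smul_legs`, `biBubbleTable_smul_legs`, `baseKer_biBubbleTable_smul_legs`; at `fullSum` level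
  (convergent word) `fullSum_word_smul_legs`, and the owner's literal `W(c•A,c•A) = c²·W(A,A)`: **`fullSum_word_smul_self`**.
* §2 [our object] unfoldings `ghSec_zero`, `ghWt_zero`; [folklore] (CONV) of the two comparison words (`conv_ghostWord_Ggh` from `spr_Ggh`∕`biLoc_ghCur`,
  `conv_ghostWord_frozen`), the ghost instance **`fullSum_ghostWord_regrade`** (`W(n²•Ggh, n²•Ggh) = n⁴·W(Ggh, Ggh)` over `ghCur`, `ghCur`; `0 < a`);
  THE SPLIT IDENTITY, pointwise, any exponentially bounded profile `g`: **`sum_restK'_gbubKin_eq`** (`Σ_{r r′ : Fin 2}`, the `0000` word being `0`) and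
  **`restK'_gbubKin_three_eq`** (the three words `(0,1) + (1,0) + (1,1)` explicitly).
* §3 [folklore] AT `fullSum` LEVEL AND OVER THE BLOCK at the END's profile `gfrz n a b` (`Spr (Ga n a)`, `0 < a`): **`fullSum_sum_restK'_gbubKin_eq`**
  (one base site), **`blockSum_sum_restK'_gbubKin_eq`** (the END's expression `Σ_{b ∈ image resSite} n⁻⁴·fullSum (…)` summed over the indices).
NOT HERE (honest): any bound; the size of either comparison word; the (i)∕(ii) question (Q-GU-1, an2); the re-split of the LOCAL row; `hGrp_of_rows`.
Unit `b2b-balaban-gan24-formalise-leaf-05` (gen 43), at the road OWNER's request ρ-g11-4 (b); `LEAVES-BFx.md` row «L-GBUB» (identity only).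
-/

noncomputable section

namespace Summit.QuantumFields.BalabanUV.Beta.D1BFx.GhostBubbleRestSplit

open Finset Filter Topology
open scoped BigOperators
open Literature.MathematicalPhysics.QuantumFieldTheory.Balaban1983to89
open Literature.MathematicalPhysics.QuantumFieldTheory.Balaban1983to89.Beta
open B12Sec2to5 (l1)
open ExpKernelCalculus (Site MKer BiLoc)
open WindowIdentification (psum fullSum fullSum_const_mul)
open DyadicShell (Pt toReal)
open DressedMomentNormalisation (resSite)
open Summit.QuantumFields.BalabanUV.Beta.TameKernelCalculus (Spr Loc)
open Summit.QuantumFields.BalabanUV.Beta.D1BFx.MomentTransferPeriodic (baseKer)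
open Summit.QuantumFields.BalabanUV.Beta.D1BFx.PackedKernelSplit (biBubble)
open Summit.QuantumFields.BalabanUV.Beta.D1BFx.GluonLeg (Ga)
open Summit.QuantumFields.BalabanUV.Beta.D1BFx.GhostLeg (Ggh spr_Ggh)
open Summit.QuantumFields.BalabanUV.Beta.D1BFx.GhostStencil (ghCur biLoc_ghCur)
open Summit.QuantumFields.BalabanUV.Beta.D1BFx.ReducedKernel (TableR)
open Summit.QuantumFields.BalabanUV.Beta.D1BFx.Assembly (exists_tendsto_psum_weight_mul exists_tendsto_psum_const_mul fullSum_sub' fullSum_finset_sum)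
open Summit.QuantumFields.BalabanUV.Beta.D1BFx.FineHessianSectors (biBubbleTable biBubbleTable_apply absMoment₂_baseKer_biBubbleTable)
open Summit.QuantumFields.BalabanUV.Beta.D1BFx.FineHessianLegGrades (frozenLeg)
open Summit.QuantumFields.BalabanUV.Beta.D1BFx.FineHessianGhostGrades (ghSec ghWt ghLeg ghLeg_zero loc_ghSec biBubbleTable_Ggh_eq_pieceSum
  conv_biBubbleTable_ghost)
open Summit.QuantumFields.BalabanUV.Beta.D1BFx.FrozenLegProfile (gfrz decay_gfrz)
open Summit.QuantumFields.BalabanUV.Beta.D1BFx.SplitRecut (restK' restK'_gbub)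

/-! ## §1 Homogeneity of the two-leg word in its legs (unconditional) -/

section Homogeneity

variable {F : Type*} [Fintype F]

/-- [folklore] **THE TWO-LEG BUBBLE IS HOMOGENEOUS IN ITS LEGS** (no hypothesis: `comp`, `tr` commute with scalars termwise):
`biBubble (c•A) V (d•B) W = c·d·biBubble A V B W`. -/
theorem biBubble_smul_legs (c d : ℝ) (A V B W : MKer 4 F) : biBubble (c • A) V (d • B) W = c * d * biBubble A V B W := by
  unfold PackedKernelSplit.biBubble
  rw [StencilRealisation.comp_smul_left A V c, StencilRealisation.comp_smul_left B W d, StencilRealisation.comp_smul_left,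
    StencilRealisation.comp_smul_right, StencilRealisation.tr_smul, StencilRealisation.tr_smul, mul_assoc]

/-- [folklore] **THE TWO-LEG TABLE IS HOMOGENEOUS IN ITS LEGS**, entrywise, no hypothesis. -/
theorem biBubbleTable_smul_legs (c d : ℝ) (A B : MKer 4 F) (S T : Fin 4 → Site 4 → MKer 4 F) (κ' l' : Fin 4) (u u' : Site 4) :
    biBubbleTable (c • A) (d • B) S T κ' l' u u' = c * d * biBubbleTable A B S T κ' l' u u' := by
  rw [biBubbleTable_apply, biBubbleTable_apply, biBubble_smul_legs]
  ring

/-- [folklore] … hence so is every base-point kernel of the table. -/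
theorem baseKer_biBubbleTable_smul_legs (c d : ℝ) (A B : MKer 4 F) (S T : Fin 4 → Site 4 → MKer 4 F) (μ ν : Fin 4) (b w : Pt) :
    baseKer (biBubbleTable (c • A) (d • B) S T μ ν) b w = c * d * baseKer (biBubbleTable A B S T μ ν) b w := by
  simp only [baseKer, biBubbleTable_smul_legs]

/-- [folklore] **HOMOGENEITY OF THE WORD AT `fullSum` LEVEL**: for a two-leg word with convergent punctured partial sums,
`fullSum (n⁻⁸·w_μw_ν·baseKer (biBubbleTable (c•A) (d•B) S T)) = c·d·fullSum (n⁻⁸·w_μw_ν·baseKer (biBubbleTable A B S T))`. -/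
theorem fullSum_word_smul_legs (n : ℕ) (c d : ℝ) (A B : MKer 4 F) (S T : Fin 4 → Site 4 → MKer 4 F) (μ ν : Fin 4) (b : Pt)
    (h : ∃ L, Tendsto (psum (fun w : Pt => ((n : ℝ) ^ 8)⁻¹ * (toReal w μ * toReal w ν * baseKer (biBubbleTable A B S T μ ν) b w))) atTop (𝓝 L)) :
    fullSum (fun w : Pt => ((n : ℝ) ^ 8)⁻¹ * (toReal w μ * toReal w ν * baseKer (biBubbleTable (c • A) (d • B) S T μ ν) b w)) =
      c * d * fullSum (fun w : Pt => ((n : ℝ) ^ 8)⁻¹ * (toReal w μ * toReal w ν * baseKer (biBubbleTable A B S T μ ν) b w)) := by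
  have e : (fun w : Pt => ((n : ℝ) ^ 8)⁻¹ * (toReal w μ * toReal w ν * baseKer (biBubbleTable (c • A) (d • B) S T μ ν) b w)) =
      fun w : Pt => c * d * (((n : ℝ) ^ 8)⁻¹ * (toReal w μ * toReal w ν * baseKer (biBubbleTable A B S T μ ν) b w)) := by
    funext w
    rw [baseKer_biBubbleTable_smul_legs]
    ring
  rw [e, fullSum_const_mul (c * d) h]

/-- [folklore] **THE OWNER's LITERAL `W(c•A, c•A) = c²·W(A, A)`** (ρ-g11-4 (b)), for a convergent diagonal word. -/
theorem fullSum_word_smul_self (n : ℕ) (c : ℝ) (A : MKer 4 F) (S T : Fin 4 → Site 4 → MKer 4 F) (μ ν : Fin 4) (b : Pt)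
    (h : ∃ L, Tendsto (psum (fun w : Pt => ((n : ℝ) ^ 8)⁻¹ * (toReal w μ * toReal w ν * baseKer (biBubbleTable A A S T μ ν) b w))) atTop (𝓝 L)) :
    fullSum (fun w : Pt => ((n : ℝ) ^ 8)⁻¹ * (toReal w μ * toReal w ν * baseKer (biBubbleTable (c • A) (c • A) S T μ ν) b w)) =
      c ^ 2 * fullSum (fun w : Pt => ((n : ℝ) ^ 8)⁻¹ * (toReal w μ * toReal w ν * baseKer (biBubbleTable A A S T μ ν) b w)) := by
  rw [fullSum_word_smul_legs n c c A A S T μ ν b h, sq]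

end Homogeneity

/-! ## §2 The split identity for the KIN × KIN ghost-bubble words of the re-cut REST table, pointwise -/

section Pointwise

variable (n : ℕ) [NeZero n] (a : ℝ) (g : Pt → ℝ) (cE cΛ cR cK cQ cE₂ cJ4 cΛ₂ cR₂ cQ₂ x₀ : ℝ) (WE WJ WΛ WR WQ : TableR)
  (ωgl ωgh lam N : ℝ) (μ ν : Fin 4) (b : Pt)

omit [NeZero n] in
/-- [our object] The KIN sector is `ghCur` (unfolding `ghSec n 0`). -/
theorem ghSec_zero : ghSec n 0 = ghCur := rfl

/-- [our object] The KIN weight is `cK` (unfolding `ghWt cK cQ 0`). -/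
theorem ghWt_zero : ghWt cK cQ 0 = cK := rfl

/-- [folklore] **(CONV) OF THE FULL KIN × KIN GHOST WORD** over the raw leg `Ggh` (`0 < a`: `spr_Ggh`, `biLoc_ghCur`). -/
theorem conv_ghostWord_Ggh (ha : 0 < a) :
    ∃ L, Tendsto (psum (fun w : Pt => ((n : ℝ) ^ 8)⁻¹ *
      (toReal w μ * toReal w ν * baseKer (biBubbleTable (Ggh n a) (Ggh n a) ghCur ghCur μ ν) b w))) atTop (𝓝 L) :=
  exists_tendsto_psum_const_mul _ (exists_tendsto_psum_weight_mul
    (absMoment₂_baseKer_biBubbleTable (Ggh n a) (Ggh n a) (spr_Ggh n a ha) (spr_Ggh n a ha)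
      (fun κ u => biLoc_ghCur κ u 1) one_pos (fun κ u => biLoc_ghCur κ u 1) one_pos μ ν b) μ ν)

/-- [folklore] **THE GHOST REGRADE INSTANCE `W(n²•Ggh, n²•Ggh) = n⁴·W(Ggh, Ggh)`** over KIN × KIN (the normalisation `Gf = n²•Ggh` of ρ-g11-4 (ii)
moved through the word by §1; `0 < a`).  An identity; it does not choose between the readings. -/
theorem fullSum_ghostWord_regrade (ha : 0 < a) :
    fullSum (fun w : Pt => ((n : ℝ) ^ 8)⁻¹ * (toReal w μ * toReal w ν *
      baseKer (biBubbleTable (((n : ℝ) ^ 2) • Ggh n a) (((n : ℝ) ^ 2) • Ggh n a) ghCur ghCur μ ν) b w)) =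
      (n : ℝ) ^ 4 * fullSum (fun w : Pt => ((n : ℝ) ^ 8)⁻¹ *
        (toReal w μ * toReal w ν * baseKer (biBubbleTable (Ggh n a) (Ggh n a) ghCur ghCur μ ν) b w)) := by
  rw [fullSum_word_smul_self n _ (Ggh n a) ghCur ghCur μ ν b (conv_ghostWord_Ggh n a μ ν b ha)]
  ring

variable {g} in
/-- [folklore] **(CONV) OF MAIN-gh's PARENT WORD** over the frozen leg (exponentially bounded profile; `0 < a`). -/
theorem conv_ghostWord_frozen (ha : 0 < a) {C δ : ℝ} (hδ : 0 < δ) (hg : ∀ v, |g v| ≤ C * Real.exp (-δ * l1 v)) :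
    ∃ L, Tendsto (psum (fun w : Pt => ((n : ℝ) ^ 8)⁻¹ *
      (toReal w μ * toReal w ν * baseKer (biBubbleTable (frozenLeg g) (frozenLeg g) ghCur ghCur μ ν) b w))) atTop (𝓝 L) := by
  have h := conv_biBubbleTable_ghost n a ha hδ hg 0 0 0 0 μ ν b
  simpa only [ghLeg_zero, ghSec_zero] using h

variable {g} in
/-- [folklore] **THE SPLIT IDENTITY, POINTWISE** (any exponentially bounded profile `g`, `0 < a`): the sum over ALL FOUR leg grades of the re-cut
KIN × KIN ghost-bubble words — the `0000` word being `0` by `SplitRecut.restK'` — IS the full KIN × KIN ghost word over `Ggh` minus MAIN-gh's parent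
word over `frozenLeg g`, with the common weight `ωgh·cK·cK·n⁻⁸·w_μ·w_ν`. -/
theorem sum_restK'_gbubKin_eq (ha : 0 < a) {C δ : ℝ} (hδ : 0 < δ) (hg : ∀ v, |g v| ≤ C * Real.exp (-δ * l1 v)) (w : Pt) :
    ∑ r : Fin 2, ∑ r' : Fin 2,
        restK' n a g cE cΛ cR cK cQ cE₂ cJ4 cΛ₂ cR₂ cQ₂ x₀ WE WJ WΛ WR WQ ωgl ωgh lam N μ ν b (Sum.inr (Sum.inr (Sum.inr (Sum.inl ((0 : Fin 2), (0 : Fin 2), r, r'))))) w =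
      ωgh * (cK * cK * (((n : ℝ) ^ 8)⁻¹ * (toReal w μ * toReal w ν * baseKer (biBubbleTable (Ggh n a) (Ggh n a) ghCur ghCur μ ν) b w))) -
        ωgh * (cK * cK * (((n : ℝ) ^ 8)⁻¹ * (toReal w μ * toReal w ν * baseKer (biBubbleTable (frozenLeg g) (frozenLeg g) ghCur ghCur μ ν) b w))) := by
  have hsplit : baseKer (biBubbleTable (Ggh n a) (Ggh n a) ghCur ghCur μ ν) b w =
      ∑ r : Fin 2, ∑ r' : Fin 2, baseKer (biBubbleTable (ghLeg n a g r) (ghLeg n a g r') ghCur ghCur μ ν) b w := by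
    simp only [baseKer]
    rw [← ghSec_zero n]
    exact biBubbleTable_Ggh_eq_pieceSum n a ha hδ hg (loc_ghSec n 0) (loc_ghSec n 0) μ ν (b + w) b
  have hfro : baseKer (biBubbleTable (frozenLeg g) (frozenLeg g) ghCur ghCur μ ν) b w =
      baseKer (biBubbleTable (ghLeg n a g 0) (ghLeg n a g 0) ghCur ghCur μ ν) b w := by
    rw [ghLeg_zero]
  rw [hsplit, hfro]
  simp only [Fin.sum_univ_two, restK'_gbub, ghWt_zero, ghSec_zero, Fin.isValue, Prod.mk.injEq, one_ne_zero, and_false, and_true,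
    and_self, if_true, if_false]
  ring

variable {g} in
/-- [folklore] **THE THREE L-GBUB WORDS EXPLICITLY**: `(0,1) + (1,0) + (1,1)` = full KIN × KIN ghost word minus the frozen-leg word (same weight). -/
theorem restK'_gbubKin_three_eq (ha : 0 < a) {C δ : ℝ} (hδ : 0 < δ) (hg : ∀ v, |g v| ≤ C * Real.exp (-δ * l1 v)) (w : Pt) :
    restK' n a g cE cΛ cR cK cQ cE₂ cJ4 cΛ₂ cR₂ cQ₂ x₀ WE WJ WΛ WR WQ ωgl ωgh lam N μ ν b
        (Sum.inr (Sum.inr (Sum.inr (Sum.inl ((0 : Fin 2), (0 : Fin 2), (0 : Fin 2), (1 : Fin 2)))))) w +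
      restK' n a g cE cΛ cR cK cQ cE₂ cJ4 cΛ₂ cR₂ cQ₂ x₀ WE WJ WΛ WR WQ ωgl ωgh lam N μ ν b
        (Sum.inr (Sum.inr (Sum.inr (Sum.inl ((0 : Fin 2), (0 : Fin 2), (1 : Fin 2), (0 : Fin 2)))))) w +
      restK' n a g cE cΛ cR cK cQ cE₂ cJ4 cΛ₂ cR₂ cQ₂ x₀ WE WJ WΛ WR WQ ωgl ωgh lam N μ ν b
        (Sum.inr (Sum.inr (Sum.inr (Sum.inl ((0 : Fin 2), (0 : Fin 2), (1 : Fin 2), (1 : Fin 2)))))) w =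
      ωgh * (cK * cK * (((n : ℝ) ^ 8)⁻¹ * (toReal w μ * toReal w ν * baseKer (biBubbleTable (Ggh n a) (Ggh n a) ghCur ghCur μ ν) b w))) -
        ωgh * (cK * cK * (((n : ℝ) ^ 8)⁻¹ * (toReal w μ * toReal w ν * baseKer (biBubbleTable (frozenLeg g) (frozenLeg g) ghCur ghCur μ ν) b w))) := by
  rw [← sum_restK'_gbubKin_eq n a cE cΛ cR cK cQ cE₂ cJ4 cΛ₂ cR₂ cQ₂ x₀ WE WJ WΛ WR WQ ωgl ωgh lam N μ ν b ha hδ hg w]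
  have h00 : restK' n a g cE cΛ cR cK cQ cE₂ cJ4 cΛ₂ cR₂ cQ₂ x₀ WE WJ WΛ WR WQ ωgl ωgh lam N μ ν b
      (Sum.inr (Sum.inr (Sum.inr (Sum.inl ((0 : Fin 2), (0 : Fin 2), (0 : Fin 2), (0 : Fin 2)))))) w = 0 := by
    rw [restK'_gbub]
    simp
  simp only [Fin.sum_univ_two, h00, zero_add, add_assoc]

end Pointwise

/-! ## §3 At `fullSum` level and over the block, at the END's frozen profile `gfrz n a b` -/

section Block

variable (n : ℕ) [NeZero n] (a : ℝ) (cE cΛ cR cK cQ cE₂ cJ4 cΛ₂ cR₂ cQ₂ x₀ : ℝ) (WE WJ WΛ WR WQ : TableR)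
  (ωgl ωgh lam N : ℝ) (μ ν : Fin 4)

/-- [folklore] **THE SPLIT IDENTITY AT `fullSum` LEVEL, ONE BASE SITE**, profile `gfrz n a b` (`0 < a`, `Spr (Ga n a)` for the profile's decay):
`Σ_{r r′} fullSum (restK′ … (inr³ (inl (0,0,r,r′)))) = ωgh·cK·cK·(fullSum (full KIN×KIN ghost word) − fullSum (frozen-leg word))`. -/
theorem fullSum_sum_restK'_gbubKin_eq (ha : 0 < a) (hGa : Spr (Ga n a)) (b : Pt) :
    ∑ r : Fin 2, ∑ r' : Fin 2, fullSum (fun w : Pt =>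
        restK' n a (gfrz n a b) cE cΛ cR cK cQ cE₂ cJ4 cΛ₂ cR₂ cQ₂ x₀ WE WJ WΛ WR WQ ωgl ωgh lam N μ ν b
          (Sum.inr (Sum.inr (Sum.inr (Sum.inl ((0 : Fin 2), (0 : Fin 2), r, r'))))) w) =
      ωgh * (cK * cK) *
        (fullSum (fun w : Pt => ((n : ℝ) ^ 8)⁻¹ * (toReal w μ * toReal w ν * baseKer (biBubbleTable (Ggh n a) (Ggh n a) ghCur ghCur μ ν) b w)) -
          fullSum (fun w : Pt => ((n : ℝ) ^ 8)⁻¹ *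
            (toReal w μ * toReal w ν * baseKer (biBubbleTable (frozenLeg (gfrz n a b)) (frozenLeg (gfrz n a b)) ghCur ghCur μ ν) b w))) := by
  obtain ⟨C, δ, hδ, hg⟩ := decay_gfrz (n := n) (a := a) hGa b
  have hconv : ∀ r r' : Fin 2, ∃ L, Tendsto (psum (fun w : Pt =>
      restK' n a (gfrz n a b) cE cΛ cR cK cQ cE₂ cJ4 cΛ₂ cR₂ cQ₂ x₀ WE WJ WΛ WR WQ ωgl ωgh lam N μ ν b
        (Sum.inr (Sum.inr (Sum.inr (Sum.inl ((0 : Fin 2), (0 : Fin 2), r, r'))))) w)) atTop (𝓝 L) := by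
    intro r r'
    by_cases h0 : ((0 : Fin 2), (0 : Fin 2), r, r') = ((0 : Fin 2), (0 : Fin 2), (0 : Fin 2), (0 : Fin 2))
    · refine ⟨0, ?_⟩
      have e : (fun w : Pt => restK' n a (gfrz n a b) cE cΛ cR cK cQ cE₂ cJ4 cΛ₂ cR₂ cQ₂ x₀ WE WJ WΛ WR WQ ωgl ωgh lam N μ ν b
          (Sum.inr (Sum.inr (Sum.inr (Sum.inl ((0 : Fin 2), (0 : Fin 2), r, r'))))) w) = fun _ => 0 := by
        funext w
        rw [restK'_gbub, if_pos h0, mul_zero]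
      have e' : psum (fun _ : Pt => (0 : ℝ)) = fun _ => 0 := funext fun R => by simp [WindowIdentification.psum_def]
      rw [e, e']
      exact tendsto_const_nhds
    · have h := exists_tendsto_psum_const_mul (ωgh * (ghWt cK cQ 0 * ghWt cK cQ 0))
        (conv_biBubbleTable_ghost n a (g := gfrz n a b) ha hδ hg r r' 0 0 μ ν b)
      have e : (fun w : Pt => restK' n a (gfrz n a b) cE cΛ cR cK cQ cE₂ cJ4 cΛ₂ cR₂ cQ₂ x₀ WE WJ WΛ WR WQ ωgl ωgh lam N μ ν b
          (Sum.inr (Sum.inr (Sum.inr (Sum.inl ((0 : Fin 2), (0 : Fin 2), r, r'))))) w) = fun w : Pt => ωgh * (ghWt cK cQ 0 * ghWt cK cQ 0) *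
            (((n : ℝ) ^ 8)⁻¹ * (toReal w μ * toReal w ν *
              baseKer (biBubbleTable (ghLeg n a (gfrz n a b) r) (ghLeg n a (gfrz n a b) r') (ghSec n 0) (ghSec n 0) μ ν) b w)) := by
        funext w
        rw [restK'_gbub, if_neg h0]
        ring
      rw [e]
      exact h
  have hsum : ∑ r : Fin 2, ∑ r' : Fin 2, fullSum (fun w : Pt =>
      restK' n a (gfrz n a b) cE cΛ cR cK cQ cE₂ cJ4 cΛ₂ cR₂ cQ₂ x₀ WE WJ WΛ WR WQ ωgl ωgh lam N μ ν b
        (Sum.inr (Sum.inr (Sum.inr (Sum.inl ((0 : Fin 2), (0 : Fin 2), r, r'))))) w) =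
      fullSum (fun w : Pt => ∑ r : Fin 2, ∑ r' : Fin 2,
        restK' n a (gfrz n a b) cE cΛ cR cK cQ cE₂ cJ4 cΛ₂ cR₂ cQ₂ x₀ WE WJ WΛ WR WQ ωgl ωgh lam N μ ν b
          (Sum.inr (Sum.inr (Sum.inr (Sum.inl ((0 : Fin 2), (0 : Fin 2), r, r'))))) w) := by
    rw [fullSum_finset_sum univ (fun r _ => Assembly.exists_tendsto_psum_finset_sum univ fun r' _ => hconv r r')]
    exact sum_congr rfl fun r _ => (fullSum_finset_sum univ fun r' _ => hconv r r').symm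
  have e : (fun w : Pt => ∑ r : Fin 2, ∑ r' : Fin 2,
      restK' n a (gfrz n a b) cE cΛ cR cK cQ cE₂ cJ4 cΛ₂ cR₂ cQ₂ x₀ WE WJ WΛ WR WQ ωgl ωgh lam N μ ν b
        (Sum.inr (Sum.inr (Sum.inr (Sum.inl ((0 : Fin 2), (0 : Fin 2), r, r'))))) w) =
      fun w : Pt => ωgh * (cK * cK) * (((n : ℝ) ^ 8)⁻¹ * (toReal w μ * toReal w ν * baseKer (biBubbleTable (Ggh n a) (Ggh n a) ghCur ghCur μ ν) b w)) -
        ωgh * (cK * cK) * (((n : ℝ) ^ 8)⁻¹ *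
          (toReal w μ * toReal w ν * baseKer (biBubbleTable (frozenLeg (gfrz n a b)) (frozenLeg (gfrz n a b)) ghCur ghCur μ ν) b w)) := by
    funext w
    rw [sum_restK'_gbubKin_eq n a cE cΛ cR cK cQ cE₂ cJ4 cΛ₂ cR₂ cQ₂ x₀ WE WJ WΛ WR WQ ωgl ωgh lam N μ ν b ha hδ hg w]
    ring
  rw [hsum, e, fullSum_sub' (exists_tendsto_psum_const_mul _ (conv_ghostWord_Ggh n a μ ν b ha))
      (exists_tendsto_psum_const_mul _ (conv_ghostWord_frozen n a μ ν b ha hδ hg)),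
    fullSum_const_mul _ (conv_ghostWord_Ggh n a μ ν b ha), fullSum_const_mul _ (conv_ghostWord_frozen n a μ ν b ha hδ hg)]
  ring

/-- [folklore] **THE SPLIT IDENTITY OVER THE BLOCK — THE END's EXPRESSION**: summing `LocalGroupRow.hLoc_of_prop12`'s ∕ `RoadEndBFxRows.hGrp_of_rows`'s
per-word quantity `Σ_{b ∈ image resSite} n⁻⁴·fullSum (w ↦ restK′ n a (gfrz n a b) … b τ w)` over the four KIN × KIN ghost-bubble indices
`τ = inr³ (inl (0,0,r,r′))` (the `0000` one contributing `0`) gives `ωgh·cK²·Σ_b n⁻⁴·(W_b(Ggh,Ggh) − W_b(fL_b,fL_b))` — the full KIN × KIN ghost bubble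
minus MAIN-gh's parent, block-summed.  `0 < a`, `Spr (Ga n a)`; every other parameter free.  NO BOUND is asserted. -/
theorem blockSum_sum_restK'_gbubKin_eq (ha : 0 < a) (hGa : Spr (Ga n a)) :
    ∑ r : Fin 2, ∑ r' : Fin 2, ∑ b ∈ (univ : Finset (Fin 4 → Fin n)).image resSite, ((n : ℝ) ^ 4)⁻¹ *
        fullSum (fun w : Pt => restK' n a (gfrz n a b) cE cΛ cR cK cQ cE₂ cJ4 cΛ₂ cR₂ cQ₂ x₀ WE WJ WΛ WR WQ ωgl ωgh lam N μ ν b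
          (Sum.inr (Sum.inr (Sum.inr (Sum.inl ((0 : Fin 2), (0 : Fin 2), r, r'))))) w) =
      ωgh * cK ^ 2 * ∑ b ∈ (univ : Finset (Fin 4 → Fin n)).image resSite, ((n : ℝ) ^ 4)⁻¹ *
        (fullSum (fun w : Pt => ((n : ℝ) ^ 8)⁻¹ * (toReal w μ * toReal w ν * baseKer (biBubbleTable (Ggh n a) (Ggh n a) ghCur ghCur μ ν) b w)) -
          fullSum (fun w : Pt => ((n : ℝ) ^ 8)⁻¹ *
            (toReal w μ * toReal w ν * baseKer (biBubbleTable (frozenLeg (gfrz n a b)) (frozenLeg (gfrz n a b)) ghCur ghCur μ ν) b w))) := by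
  have key := fun b : Pt => fullSum_sum_restK'_gbubKin_eq n a cE cΛ cR cK cQ cE₂ cJ4 cΛ₂ cR₂ cQ₂ x₀ WE WJ WΛ WR WQ ωgl ωgh lam N μ ν ha hGa b
  symm
  calc ωgh * cK ^ 2 * ∑ b ∈ (univ : Finset (Fin 4 → Fin n)).image resSite, ((n : ℝ) ^ 4)⁻¹ *
        (fullSum (fun w : Pt => ((n : ℝ) ^ 8)⁻¹ * (toReal w μ * toReal w ν * baseKer (biBubbleTable (Ggh n a) (Ggh n a) ghCur ghCur μ ν) b w)) -
          fullSum (fun w : Pt => ((n : ℝ) ^ 8)⁻¹ *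
            (toReal w μ * toReal w ν * baseKer (biBubbleTable (frozenLeg (gfrz n a b)) (frozenLeg (gfrz n a b)) ghCur ghCur μ ν) b w)))
      = ∑ b ∈ (univ : Finset (Fin 4 → Fin n)).image resSite, ((n : ℝ) ^ 4)⁻¹ * (ωgh * (cK * cK) *
        (fullSum (fun w : Pt => ((n : ℝ) ^ 8)⁻¹ * (toReal w μ * toReal w ν * baseKer (biBubbleTable (Ggh n a) (Ggh n a) ghCur ghCur μ ν) b w)) -
          fullSum (fun w : Pt => ((n : ℝ) ^ 8)⁻¹ *
            (toReal w μ * toReal w ν * baseKer (biBubbleTable (frozenLeg (gfrz n a b)) (frozenLeg (gfrz n a b)) ghCur ghCur μ ν) b w)))) := by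
        rw [Finset.mul_sum]
        exact sum_congr rfl fun b _ => by ring
    _ = ∑ b ∈ (univ : Finset (Fin 4 → Fin n)).image resSite, ((n : ℝ) ^ 4)⁻¹ * ∑ r : Fin 2, ∑ r' : Fin 2, fullSum (fun w : Pt =>
        restK' n a (gfrz n a b) cE cΛ cR cK cQ cE₂ cJ4 cΛ₂ cR₂ cQ₂ x₀ WE WJ WΛ WR WQ ωgl ωgh lam N μ ν b
          (Sum.inr (Sum.inr (Sum.inr (Sum.inl ((0 : Fin 2), (0 : Fin 2), r, r'))))) w) :=
        sum_congr rfl fun b _ => by rw [key b]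
    _ = _ := by simp only [Fin.sum_univ_two, mul_add, Finset.sum_add_distrib]

end Block

end Summit.QuantumFields.BalabanUV.Beta.D1BFx.GhostBubbleRestSplit

end
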